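import Summits.QuantumFields.YangMills.Theorems.ThermalDescentMaxwellRungKernel

/-!
# `ThermalDescent` / `ZeroTemperatureFloors` BC5 rung — file 3/6: thermal images — summability, symmetry, tracelessness,
# evenness and measurability of `H_T = Σₙ ∂∂|z + nTe₀|⁻²`; `k_T = 2 tr H_T² + (tr H_T)² ≥ 0`

Tribunal-w seat `ym-td-bc5w-1` (planner, gen 2).  The six files `ThermalDescentMaxwellRung{Defs,Kernel,Images,Window,
Chain,Floors}` are the ≤ 400-line Theorems split of the crux workfile
`Cruxes/ZeroTemperatureFloors/Lines/rung_maxwell.lean` (commit 53ced2b6fc84): the thermal free Maxwell₄ field as a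
DECIDED SEPARATING MODEL for the deciding crux `ZeroTemperatureFloors` (stmt-QuantumFields-25390) of route
`ThermalDescent` — statement, dictionary and mechanism in `…Floors`.  Helper files (`--supports` the crux), close nothing;
route-independent (imports `Mathlib`, the Mathlib-only certificate `TreeLevelSkewnessVanishes`, `Literature…EuclideanAction`).

`H_T(z)` is an absolutely convergent entrywise image sum at every point for `T > 0` (`summable_entry_img`: far images are
`O(n⁻⁴T⁻⁴)`), symmetric, even and traceless (`thermalHess_trace`: the trace commutes with the convergent sum), its entries are
measurable in `z` as pointwise limits of the symmetric partial sums (`measurable_thermalHess_entry`), and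
`k_T = 2 tr H_T² + (tr H_T)²` is non-negative and measurable (`kT_eq`, `kT_nonneg`, `measurable_kT`).

NOTHING HERE PROVES `ZeroTemperatureFloors`, `NT`, or the Yang–Mills mass gap: free-field Gaussian analysis on `ℝ⁴`,
a witness (R3/RECORD framing) that the deciding crux has content of its own outside NT's printed regime.
[cite: OsterwalderSeilerAnnPhys1978, §2–3; Luscher1977; GlimmJaffe1987, §6.3, §7]
-/

set_option autoImplicit false

open scoped SchwartzMap BigOperators Topology
open MeasureTheory Filter Topology Matrix Metric Set
open Literature.MathematicalPhysics.QuantumLattice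

noncomputable section

namespace Summit.QuantumFields.YangMills.Theorems.ThermalDescent.MaxwellRung
open Summit.QuantumFields.YangMills.Theorems.SelfNormalisedSkewness.Negative

/-! ## §B Thermal images: the periodised Hessian `H_T(z) = Σₙ ∂∂|z + nTe₀|⁻²` -/

/-- Time coordinate of the `n`-th image: `z₀ + nT`. [folklore] -/
@[simp] theorem img_apply_zero (T : ℝ) (n : ℤ) (z : E4) : img T n z 0 = z 0 + n * T := by
  simp [img, e₀]

/-- Spatial coordinates are unchanged by imaging (coordinate `1`). [folklore] -/
@[simp] theorem img_apply_one (T : ℝ) (n : ℤ) (z : E4) : img T n z 1 = z 1 := by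
  simp [img, e₀]

/-- Spatial coordinates are unchanged by imaging (coordinate `2`). [folklore] -/
@[simp] theorem img_apply_two (T : ℝ) (n : ℤ) (z : E4) : img T n z 2 = z 2 := by
  simp [img, e₀]

/-- Spatial coordinates are unchanged by imaging (coordinate `3`). [folklore] -/
@[simp] theorem img_apply_three (T : ℝ) (n : ℤ) (z : E4) : img T n z 3 = z 3 := by
  simp [img, e₀]

/-- The `0`-th image is `z` itself. [folklore] -/
@[simp] theorem img_zero (T : ℝ) (z : E4) : img T 0 z = z := by
  simp [img]

/-- Imaging preserves the spatial radius. [folklore] -/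
theorem spSq_img (T : ℝ) (n : ℤ) (z : E4) : spSq (img T n z) = spSq z := by
  simp [spSq]

/-- `|z + nTe₀|² = (z₀ + nT)² + |z⃗|²`. [folklore] -/
theorem nsq_img (T : ℝ) (n : ℤ) (z : E4) : nsq (img T n z) = (z 0 + n * T) ^ 2 + spSq z := by
  rw [nsq_eq_time_add_spSq, spSq_img, img_apply_zero]

/-- `a₀² ≤ |a|²`. [folklore] -/
theorem time_sq_le_nsq (a : E4) : a 0 ^ 2 ≤ nsq a := by
  rw [nsq_eq_time_add_spSq]; linarith [spSq_nonneg a]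

/-- Images of `−z` are reflected images of `z`: `(−z) + nTe₀ = −(z − nTe₀)`. [folklore] -/
theorem img_neg (T : ℝ) (n : ℤ) (z : E4) : img T n (-z) = -(img T (-n) z) := by
  simp only [img, Int.cast_neg, neg_mul, neg_smul]
  abel

/-! ### Measurability of the image entries -/

/-- Coordinates are continuous. [folklore] -/
theorem continuous_coord (i : Fin 4) : Continuous fun z : E4 => z i := by
  fun_prop

/-- `nsq` is continuous. [folklore] -/
theorem continuous_nsq : Continuous (nsq : E4 → ℝ) := by
  have : (nsq : E4 → ℝ) = fun z => ‖z‖ ^ 2 := funext nsq_eq_norm_sq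
  rw [this]; fun_prop

/-- Each entry of the Hessian `∂∂|a|⁻²` is a measurable function of `a`. [folklore] -/
theorem measurable_hessInvSq_entry (μ ρ : Fin 4) : Measurable fun a : E4 => hessInvSq a μ ρ := by
  have h1 : Measurable fun a : E4 => 8 * a μ * a ρ / nsq a ^ 3 :=
    (((continuous_const.mul (continuous_coord μ)).mul (continuous_coord ρ)).measurable).div
      (continuous_nsq.measurable.pow_const 3)
  have h2 : Measurable fun a : E4 => 2 * δ μ ρ / nsq a ^ 2 :=
    measurable_const.div (continuous_nsq.measurable.pow_const 2)
  exact h1.sub h2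

/-- Each entry of the `n`-th image Hessian is a measurable function of the separation. [folklore] -/
theorem measurable_hessInvSq_img (T : ℝ) (n : ℤ) (μ ρ : Fin 4) :
    Measurable fun z : E4 => hessInvSq (img T n z) μ ρ :=
  (measurable_hessInvSq_entry μ ρ).comp (measurable_id.add_const _)

/-! ### Summability of the image families at every point (`T > 0`) -/

/-- Far images are large: if `n ≠ 0` and `2|z₀| ≤ |n|T` then `|z + nTe₀|² ≥ n²T²/4`. [folklore] -/
theorem nsq_img_ge_far {T : ℝ} (hT : 0 < T) (z : E4) {n : ℤ} (hfar : 2 * |z 0| ≤ |(n : ℝ)| * T) :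
    (n : ℝ) ^ 2 * T ^ 2 / 4 ≤ nsq (img T n z) := by
  have h1 : |(n : ℝ) * T| - |z 0| ≤ |z 0 + n * T| := by
    have := abs_sub_abs_le_abs_sub ((n : ℝ) * T) (-(z 0))
    have h' : (n : ℝ) * T - -(z 0) = z 0 + n * T := by ring
    rw [h', abs_neg] at this
    exact this
  have h2 : |(n : ℝ)| * T / 2 ≤ |z 0 + n * T| := by
    rw [abs_mul, abs_of_pos hT] at h1
    linarith
  have h3 : (|(n : ℝ)| * T / 2) ^ 2 ≤ (z 0 + n * T) ^ 2 := by
    rw [← sq_abs (z 0 + n * T)]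
    exact pow_le_pow_left₀ (by positivity) h2 2
  calc (n : ℝ) ^ 2 * T ^ 2 / 4 = (|(n : ℝ)| * T / 2) ^ 2 := by rw [div_pow, mul_pow, sq_abs]; ring
    _ ≤ (z 0 + n * T) ^ 2 := h3
    _ ≤ nsq (img T n z) := by rw [← img_apply_zero]; exact time_sq_le_nsq _

/-- Entry bound on far images: `|(∂∂|z+nTe₀|⁻²)_{μρ}| ≤ 160/(n⁴T⁴)`. [folklore] -/
theorem abs_entry_img_le_far {T : ℝ} (hT : 0 < T) (z : E4) {n : ℤ} (hn : n ≠ 0)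
    (hfar : 2 * |z 0| ≤ |(n : ℝ)| * T) (μ ρ : Fin 4) :
    |hessInvSq (img T n z) μ ρ| ≤ 160 / T ^ 4 * (1 / (n : ℝ) ^ 4) := by
  have hn' : (n : ℝ) ≠ 0 := Int.cast_ne_zero.mpr hn
  have hq : 0 < (n : ℝ) ^ 2 * T ^ 2 / 4 := by positivity
  have hge := nsq_img_ge_far hT z hfar
  calc |hessInvSq (img T n z) μ ρ| ≤ 10 / nsq (img T n z) ^ 2 := abs_hessInvSq_le _ μ ρ
    _ ≤ 10 / ((n : ℝ) ^ 2 * T ^ 2 / 4) ^ 2 :=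
        div_le_div_of_nonneg_left (by norm_num) (by positivity) (pow_le_pow_left₀ hq.le hge 2)
    _ = 160 / T ^ 4 * (1 / (n : ℝ) ^ 4) := by
        field_simp
        ring

/-- **Every image family is summable** (`T > 0`, any separation, any entry). [folklore] -/
theorem summable_entry_img {T : ℝ} (hT : 0 < T) (z : E4) (μ ρ : Fin 4) :
    Summable fun n : ℤ => hessInvSq (img T n z) μ ρ := by
  have hg : Summable fun n : ℤ => 160 / T ^ 4 * (1 / (n : ℝ) ^ 4) :=
    (Real.summable_one_div_int_pow.mpr (by norm_num)).mul_left _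
  refine Summable.of_norm_bounded_eventually hg ?_
  rw [Filter.eventually_cofinite]
  set N : ℤ := ⌈2 * |z 0| / T⌉ with hN
  refine (Set.finite_Icc (-N) N).subset fun n hn => ?_
  by_contra hout
  apply hn
  have hN0 : 0 ≤ N := by
    rw [hN]; exact Int.ceil_nonneg (by positivity)
  rw [Set.mem_Icc, not_and_or, not_le, not_le] at hout
  have hN0' : (0 : ℝ) ≤ N := by exact_mod_cast hN0
  have habs : (N : ℝ) + 1 ≤ |(n : ℝ)| := by
    rcases hout with h | h
    · have h' : (n : ℝ) ≤ -(N : ℝ) - 1 := by exact_mod_cast (by omega : n ≤ -N - 1)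
      have h'' : |(n : ℝ)| = -(n : ℝ) := abs_of_neg (by linarith)
      linarith
    · have h' : (N : ℝ) + 1 ≤ (n : ℝ) := by exact_mod_cast (by omega : N + 1 ≤ n)
      have h'' : |(n : ℝ)| = (n : ℝ) := abs_of_pos (by linarith)
      linarith
  have hn0 : n ≠ 0 := by
    rintro rfl
    simp at habs
    linarith
  have hceil : 2 * |z 0| / T ≤ (N : ℝ) := by rw [hN]; exact Int.le_ceil _
  have hfar : 2 * |z 0| ≤ |(n : ℝ)| * T := by
    have : 2 * |z 0| / T * T = 2 * |z 0| := div_mul_cancel₀ _ hT.ne'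
    nlinarith
  simpa [Real.norm_eq_abs] using abs_entry_img_le_far hT z hn0 hfar μ ρ

/-- `H_T(z)` is symmetric. [folklore] -/
theorem thermalHess_isSymm (T : ℝ) (z : E4) : (thermalHess T z).IsSymm :=
  Matrix.IsSymm.ext fun μ ρ => by
    unfold thermalHess
    exact tsum_congr fun n => (hessInvSq_isSymm _).apply μ ρ

/-- `H_T` is even. [folklore] -/
theorem thermalHess_neg (T : ℝ) (z : E4) : thermalHess T (-z) = thermalHess T z := by
  ext μ ρ
  unfold thermalHess
  have h1 : (fun n : ℤ => hessInvSq (img T n (-z)) μ ρ) =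
      fun n : ℤ => (fun m : ℤ => hessInvSq (img T m z) μ ρ) ((Equiv.neg ℤ) n) := by
    funext n
    simp only [Equiv.neg_apply, img_neg, hessInvSq_neg]
  rw [h1]
  exact (Equiv.neg ℤ).tsum_eq (fun m : ℤ => hessInvSq (img T m z) μ ρ)

/-- `G_T` is even. [folklore] -/
theorem thermalKernel_neg (T : ℝ) (z : E4) : thermalKernel T (-z) = thermalKernel T z := by
  rw [thermalKernel, thermalKernel, thermalHess_neg]

/-- `H_T` is traceless (`T > 0`; the trace commutes with the convergent image sum). [folklore] -/
theorem thermalHess_trace {T : ℝ} (hT : 0 < T) (z : E4) : (thermalHess T z).trace = 0 := by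
  have h1 : (thermalHess T z).trace = ∑ μ, ∑' n : ℤ, hessInvSq (img T n z) μ μ := by
    simp [Matrix.trace, thermalHess]
  rw [h1, ← Summable.tsum_finsetSum (fun μ _ => summable_entry_img hT z μ μ)]
  have h2 : (fun n : ℤ => ∑ μ, hessInvSq (img T n z) μ μ) = fun _ => 0 := by
    funext n
    have := hessInvSq_trace (img T n z)
    simpa [Matrix.trace] using this
  rw [h2, tsum_zero]

/-- The entries of `H_T` are measurable functions of the separation (`T > 0`): pointwise limits of
the symmetric partial image sums. [folklore] -/
theorem measurable_thermalHess_entry {T : ℝ} (hT : 0 < T) (μ ρ : Fin 4) :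
    Measurable fun z : E4 => thermalHess T z μ ρ := by
  let F : ℕ → E4 → ℝ := fun N z => ∑ n ∈ Finset.Icc (-(N : ℤ)) N, hessInvSq (img T n z) μ ρ
  have hF : ∀ N, Measurable (F N) := fun N =>
    Finset.measurable_sum _ fun n _ => measurable_hessInvSq_img T n μ ρ
  refine measurable_of_tendsto_metrizable' atTop hF ?_
  rw [tendsto_pi_nhds]
  intro z
  have h1 : Tendsto (fun N : ℕ => Finset.Icc (-(N : ℤ)) N) atTop atTop :=
    tendsto_atTop_finset_of_monotone (fun a b hab => Finset.Icc_subset_Icc (by omega) (by omega))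
      (fun n => ⟨n.natAbs, by simpa using ⟨neg_abs_le n, le_abs_self n⟩⟩)
  exact (summable_entry_img hT z μ ρ).hasSum.comp h1

/-! ### The thermal even-ring density `k_T(z) = tr G_T(z)G_T(−z)` -/

/-- `k_T = 2 tr H_T² + (tr H_T)²`. [folklore] -/
theorem kT_eq (T : ℝ) (z : E4) :
    kT T z = 2 * (thermalHess T z * thermalHess T z).trace + (thermalHess T z).trace ^ 2 := by
  rw [kT, thermalKernel_neg, thermalKernel,
    trace_K_mul_K_of_isSymm (thermalHess_isSymm T z) (thermalHess_isSymm T z), sq]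

/-- `tr H² = Σ_{μρ} H_{μρ}H_{ρμ}`. [folklore] -/
theorem trace_sq_eq_sum (H : Matrix (Fin 4) (Fin 4) ℝ) :
    (H * H).trace = ∑ μ, ∑ ρ, H μ ρ * H ρ μ := by
  simp [Matrix.trace, Matrix.mul_apply]

/-- `tr H² ≥ 0` for symmetric `H`. [folklore] -/
theorem trace_sq_nonneg_of_isSymm {H : Matrix (Fin 4) (Fin 4) ℝ} (hH : H.IsSymm) :
    0 ≤ (H * H).trace := by
  rw [trace_sq_eq_sum]
  refine Finset.sum_nonneg fun μ _ => Finset.sum_nonneg fun ρ _ => ?_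
  rw [hH.apply ρ μ]  -- `H μ ρ * H ρ μ = H μ ρ * H μ ρ`? we rewrite `H ρ μ`… see check
  exact mul_self_nonneg _

/-- `k_T ≥ 0` everywhere. [folklore] -/
theorem kT_nonneg (T : ℝ) (z : E4) : 0 ≤ kT T z := by
  rw [kT_eq]
  have := trace_sq_nonneg_of_isSymm (thermalHess_isSymm T z)
  positivity

/-- `k_T` is measurable (`T > 0`). [folklore] -/
theorem measurable_kT {T : ℝ} (hT : 0 < T) : Measurable (kT T) := by
  have h : kT T = fun z => 2 * ∑ μ, ∑ ρ, thermalHess T z μ ρ * thermalHess T z ρ μ +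
      (∑ μ, thermalHess T z μ μ) ^ 2 := by
    funext z
    rw [kT_eq, trace_sq_eq_sum]
    simp [Matrix.trace]
  rw [h]
  have hE := measurable_thermalHess_entry hT
  refine ((Finset.measurable_sum _ fun μ _ => Finset.measurable_sum _ fun ρ _ =>
    (hE μ ρ).mul (hE ρ μ)).const_mul 2).add ((Finset.measurable_sum _ fun μ _ => hE μ μ).pow_const 2)

end Summit.QuantumFields.YangMills.Theorems.ThermalDescent.MaxwellRung

end
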